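import Mathlib.Analysis.Calculus.IteratedDeriv.Lemmas
import Mathlib.Analysis.Calculus.ContDiff.Operations
import Mathlib.Analysis.Calculus.MeanValue
import Mathlib.Analysis.SpecialFunctions.Pow.Real
import HarnessLib

/-!
# Derivative and increment bounds for `Ĝ = ĝ/(1 - D̂ ĝ)` along a coordinate line (Hara 2008,
# Lemma 4.1 and §4.1.4), abstract slice form with uniform constants

Barrier catalogue `Literature/Barriers/CriticalPhenomena/` (D-0021), second support file for the
discharge of `Hara2008_lemma17Pc` (`LaceExpansionXSpaceNorms.lean`: Hara 2008, Lemma 1.7 —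
Lemma 1.9 in the journal). Equation numbers below follow the Ann. Probab. version, as in the
sibling files `LaceExpansionHaraLemma41.lean` / `LaceExpansionHaraLemma41Cube.lean`.

Hara's Lemma 4.1: "Suppose `Σ_x |x|^M |Π(x)| < ∞` for a positive integer `M`. Then
`Ĝ(k) = ĝ(k)/(1 - Ĵ(k))` satisfies, for all `1 ≤ m ≤ M`, `|∂^m Ĝ(k)/∂k_j^m| ≤ c |k|^{-(2+m)}`",
proved from the explicit differentiation formula (4.21) by power counting, using
`|1 - Ĵ|^{-q} ≤ c|k|^{-2q}` and, "because `Ĵ(k)` is even in `k_j`", `|∂Ĵ| ≤ c|k|` ((4.22)).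

Relation to the tree. The one-variable mechanism of Lemma 4.1 — Leibniz on `Ĝ · (1 - Ĵ) = ĝ`
with the top term isolated, strong induction, constants depending only on the data — is ALREADY
in the tree: `norm_iteratedDeriv_div_mul_pow_le` (`LaceExpansionHaraLemma41.lean`), carried to
`|∂_j^m Ĝ(k)| ≤ C/|k|^{2+m}` on the cube (`IsLaceCoefficientPc.exists_norm_sliceDeriv_le`), to the
integrability of `∂_j^m Ĝ` and the identity (4.8) (`LaceExpansionHaraLemma41Cube.lean`) and to
the integer-`α` `Ḡ`-clause (`LaceExpansionHaraLemma17G.lean`). What the remaining clauses of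
Lemma 1.7 need IN ADDITION, and what this file provides, are bounds on INCREMENTS
`φ_G^{(m)}(s+u) - φ_G^{(m)}(s)` along the line, uniformly in the line: below the top order by the
mean value theorem (`exists_norm_incr_sliceG_le`), and at the top order `m = M` under a Hölder
hypothesis on `φ_g^{(M)}` (`exists_norm_incr_sliceG_top_le`) — the substitute for Hara's `P/Q`
split of §4.1.4 (`Ḡ^{(α)}` for `⌊φ⌋ < α ≤ φ`, listed as "not here" in `LaceExpansionHaraLemma17G`)
and the input of the finite-difference (fractional-exponent) estimates of the sequel files.
Because the increment bounds are proved by re-running the Leibniz identity at two points, the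
file carries its own copy of the derivative recursion (`exists_norm_iteratedDeriv_sliceG_le`),
in a form with the infrared exponent decoupled from the per-derivative cost: hypotheses
`|φ_A| ≥ c r²`, `|φ_A'| ≤ C r^{2-κ}`, `|φ_A^{(i)}|, |φ_g^{(i)}| ≤ C` give
`|φ_G^{(m)}| ≤ B_m r^{-(2+mκ)}`; `κ = 1` is Hara's case (the `a = 0` case of
`norm_iteratedDeriv_div_mul_pow_le`), `κ = 2` the crude case without the evenness bound.
Everything is stated ABSTRACTLY for functions `ℝ → ℂ` (`HaraNorms.SliceHyp`: `φ_g = ĝ`,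
`φ_D = 2dp_c D̂` on the line, `φ_A = 1 - φ_D φ_g = 1 - Ĵ`, `φ_G = φ_g/φ_A = Ĝ`), with constants
depending only on `(M, κ, c, C)`; the instantiation for `IsLaceCoefficientPc` (over
`kspaceTwoPoint`, `sliceDeriv`, `latticeFTDn` of the sibling files) is the sequel
`LaceExpansionXSpaceNormsSlices.lean`.

## References

* T. Hara, Ann. Probab. 36 (2008) 530–593 (arXiv:math-ph/0504021): Lemma 4.1 ((4.6)–(4.7))
  and its proof (§4.2, (4.20)–(4.27)); §4.1.4 (the case `α > ⌊φ⌋`).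
-/

noncomputable section

namespace Literature.Barriers.CriticalPhenomena.HaraNorms

open Set Finset

/-! ### The abstract slice hypotheses -/

/-- `φ_A = 1 - φ_D φ_g` (on a line: `1 - Ĵ = 1 - 2dp_c D̂ ĝ`). [cite: Hara2008, Prop. 1.2 (Ĵ_p = 2dp D̂{1 + Π̂_p})] -/
def sliceA (φg φD : ℝ → ℂ) : ℝ → ℂ := fun s => 1 - φD s * φg s

/-- `φ_G = φ_g / φ_A` (on a line: `Ĝ = ĝ/(1 - Ĵ)`). [cite: Hara2008, (1.9) and Lemma 4.1] -/
def sliceG (φg φD : ℝ → ℂ) : ℝ → ℂ := fun s => φg s / sliceA φg φD s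

/-- **Hypotheses on a coordinate slice of `ĝ` and `2dp_c D̂`** (orders of differentiability,
uniform bounds on derivatives, the infrared lower bound `|1 - Ĵ| ≥ c r²` and the first-order
vanishing `|φ'| ≤ C r^{2-κ}` of the first derivatives at the singularity, in terms of an abstract
"distance to `2πℤ^d`" function `0 < r ≤ 1`); `κ = 1` with the evenness bound `|∂Ĵ| ≤ c|k|`,
`κ = 2` without. [cite: Hara2008, proof of Lemma 4.1 ((4.20), (4.22), "`|1-Ĵ|^{-q} ≤ c|k|^{-2q}`")] -/
structure SliceHyp (M : ℕ) (κ c C : ℝ) (φg φD : ℝ → ℂ) (r : ℝ → ℝ) : Prop where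
  /-- `1 ≤ κ`. -/
  one_le_kappa : 1 ≤ κ
  /-- `κ ≤ 2`. -/
  kappa_le_two : κ ≤ 2
  /-- `c > 0`. -/
  c_pos : 0 < c
  /-- `C ≥ 1` (a convenient normalisation of the upper constants). -/
  one_le_C : 1 ≤ C
  /-- `φ_g ∈ C^M`. -/
  contDiff_g : ContDiff ℝ M φg
  /-- `φ_D ∈ C^{M+1}`. -/
  contDiff_D : ContDiff ℝ (M + 1) φD
  /-- `r > 0`. -/
  r_pos : ∀ s, 0 < r s
  /-- `r ≤ 1`. -/
  r_le_one : ∀ s, r s ≤ 1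
  /-- the infrared bound `c r² ≤ |1 - φ_D φ_g|`. -/
  lower : ∀ s, c * r s ^ 2 ≤ ‖1 - φD s * φg s‖
  /-- `|φ_g^{(i)}| ≤ C`, `i ≤ M`. -/
  g_bound : ∀ i, i ≤ M → ∀ s, ‖iteratedDeriv i φg s‖ ≤ C
  /-- `|φ_D^{(i)}| ≤ C`, `i ≤ M + 1`. -/
  D_bound : ∀ i, i ≤ M + 1 → ∀ s, ‖iteratedDeriv i φD s‖ ≤ C
  /-- `|φ_g'| ≤ C r^{2-κ}` (when `M ≥ 1`). -/
  g_one : 1 ≤ M → ∀ s, ‖iteratedDeriv 1 φg s‖ ≤ C * r s ^ (2 - κ)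
  /-- `|φ_D'| ≤ C r^{2-κ}`. -/
  D_one : ∀ s, ‖iteratedDeriv 1 φD s‖ ≤ C * r s ^ (2 - κ)

namespace SliceHyp

variable {M : ℕ} {κ c C : ℝ} {φg φD : ℝ → ℂ} {r : ℝ → ℝ}

/-- `φ_A ≠ 0`. [folklore] -/
theorem sliceA_ne_zero (h : SliceHyp M κ c C φg φD r) (s : ℝ) : sliceA φg φD s ≠ 0 := by
  intro h0
  have := h.lower s
  rw [sliceA] at h0
  rw [h0, norm_zero] at this
  have : 0 < c * r s ^ 2 := mul_pos h.c_pos (pow_pos (h.r_pos s) 2)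
  linarith

/-- `c r² ≤ ‖φ_A‖`. [folklore] -/
theorem le_norm_sliceA (h : SliceHyp M κ c C φg φD r) (s : ℝ) : c * r s ^ 2 ≤ ‖sliceA φg φD s‖ :=
  h.lower s

/-- `φ_A ∈ C^M`. [folklore] -/
theorem contDiff_sliceA (h : SliceHyp M κ c C φg φD r) : ContDiff ℝ M (sliceA φg φD) :=
  contDiff_const.sub ((h.contDiff_D.of_le (by exact_mod_cast Nat.le_succ M)).mul h.contDiff_g)

/-- `φ_G ∈ C^M`. [folklore] -/
theorem contDiff_sliceG (h : SliceHyp M κ c C φg φD r) : ContDiff ℝ M (sliceG φg φD) := by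
  have hG : sliceG φg φD = fun s => φg s * (sliceA φg φD s)⁻¹ := funext fun s => div_eq_mul_inv _ _
  rw [hG]
  exact h.contDiff_g.mul (h.contDiff_sliceA.inv h.sliceA_ne_zero)

/-- `φ_G φ_A = φ_g`. [folklore] -/
theorem sliceG_mul_sliceA (h : SliceHyp M κ c C φg φD r) : sliceG φg φD * sliceA φg φD = φg := by
  funext s
  simp only [Pi.mul_apply, sliceG]
  exact div_mul_cancel₀ _ (h.sliceA_ne_zero s)

/-- `0 < r ≤ 1` gives `r^{-a} ≤ r^{-b}` for `a ≤ b`. [folklore] -/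
theorem rpow_neg_le_rpow_neg (h : SliceHyp M κ c C φg φD r) (s : ℝ) {a b : ℝ} (hab : a ≤ b) :
    r s ^ (-a) ≤ r s ^ (-b) :=
  Real.rpow_le_rpow_of_exponent_ge (h.r_pos s) (h.r_le_one s) (neg_le_neg hab)

/-- `0 ≤ C`. [folklore] -/
theorem C_nonneg (h : SliceHyp M κ c C φg φD r) : 0 ≤ C := le_trans zero_le_one h.one_le_C

/-! ### Bounds on the derivatives of `φ_A = 1 - φ_D φ_g` -/

/-- **Leibniz bound**: `‖(φ_D φ_g)^{(i)}‖ ≤ Σ_j C(i,j) ‖φ_D^{(j)}‖ ‖φ_g^{(i-j)}‖`. [folklore] -/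
theorem norm_iteratedDeriv_mul_le (h : SliceHyp M κ c C φg φD r) {i : ℕ} (hi : i ≤ M) (s : ℝ) :
    ‖iteratedDeriv i (fun t => φD t * φg t) s‖ ≤
      ∑ j ∈ Finset.range (i + 1), (i.choose j : ℝ) * ‖iteratedDeriv j φD s‖ * ‖iteratedDeriv (i - j) φg s‖ := by
  have hD : ContDiffAt ℝ i φD s :=
    (h.contDiff_D.of_le (by exact_mod_cast (Nat.le_succ_of_le hi))).contDiffAt
  have hg : ContDiffAt ℝ i φg s := (h.contDiff_g.of_le (by exact_mod_cast hi)).contDiffAt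
  rw [iteratedDeriv_fun_mul hD hg]
  refine (norm_sum_le _ _).trans (Finset.sum_le_sum fun j _ => le_of_eq ?_)
  rw [norm_mul, norm_mul, Complex.norm_natCast]

/-- The constant bounding the derivatives of `φ_A`: `K = 2^{M+1} C²`. [folklore] -/
def KA (M : ℕ) (C : ℝ) : ℝ := 2 ^ (M + 1) * C ^ 2

/-- `1 ≤ K_A` and `C² ≤ K_A`. [folklore] -/
theorem one_le_KA (h : SliceHyp M κ c C φg φD r) : 1 ≤ KA M C := by
  have h1 : (1 : ℝ) ≤ 2 ^ (M + 1) := one_le_pow₀ (by norm_num)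
  have h2 : (1 : ℝ) ≤ C ^ 2 := one_le_pow₀ h.one_le_C
  rw [KA]; nlinarith

/-- `‖φ_A^{(i)}‖ ≤ K_A` for `1 ≤ i ≤ M` (the constant `1` disappears). [folklore] -/
theorem norm_iteratedDeriv_sliceA_le (h : SliceHyp M κ c C φg φD r) {i : ℕ} (hi1 : 1 ≤ i) (hi : i ≤ M)
    (s : ℝ) : ‖iteratedDeriv i (sliceA φg φD) s‖ ≤ KA M C := by
  have hD : ContDiffAt ℝ i φD s :=
    (h.contDiff_D.of_le (by exact_mod_cast (Nat.le_succ_of_le hi))).contDiffAt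
  have hg : ContDiffAt ℝ i φg s := (h.contDiff_g.of_le (by exact_mod_cast hi)).contDiffAt
  have hsub : iteratedDeriv i (sliceA φg φD) s = -iteratedDeriv i (fun t => φD t * φg t) s := by
    have h1 : sliceA φg φD = (fun _ : ℝ => (1 : ℂ)) - fun t => φD t * φg t := by
      funext t; simp [sliceA]
    rw [h1, iteratedDeriv_sub contDiffAt_const (hD.mul hg), iteratedDeriv_const, if_neg (by omega), zero_sub]
  rw [hsub, norm_neg]
  refine (h.norm_iteratedDeriv_mul_le hi s).trans ?_
  calc ∑ j ∈ Finset.range (i + 1), (i.choose j : ℝ) * ‖iteratedDeriv j φD s‖ * ‖iteratedDeriv (i - j) φg s‖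
      ≤ ∑ j ∈ Finset.range (i + 1), (i.choose j : ℝ) * C * C := by
        refine Finset.sum_le_sum fun j hj => ?_
        have hj' : j ≤ i := Nat.lt_succ_iff.1 (Finset.mem_range.1 hj)
        have h1 := h.D_bound j (by omega) s
        have h2 := h.g_bound (i - j) (by omega) s
        have h3 : (0 : ℝ) ≤ i.choose j := Nat.cast_nonneg _
        calc (i.choose j : ℝ) * ‖iteratedDeriv j φD s‖ * ‖iteratedDeriv (i - j) φg s‖
            ≤ (i.choose j : ℝ) * C * ‖iteratedDeriv (i - j) φg s‖ := by gcongr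
          _ ≤ (i.choose j : ℝ) * C * C := by
              have : 0 ≤ (i.choose j : ℝ) * C := mul_nonneg h3 h.C_nonneg
              gcongr
    _ = 2 ^ i * C ^ 2 := by
        rw [← Finset.sum_mul, ← Finset.sum_mul]
        have : ∑ j ∈ Finset.range (i + 1), (i.choose j : ℝ) = 2 ^ i := by exact_mod_cast Nat.sum_range_choose i
        rw [this]; ring
    _ ≤ KA M C := by
        rw [KA]
        have : (2 : ℝ) ^ i ≤ 2 ^ (M + 1) := pow_le_pow_right₀ (by norm_num) (by omega)
        have hC2 : 0 ≤ C ^ 2 := sq_nonneg C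
        nlinarith

/-- `‖φ_A‖ ≤ K_A`. [folklore] -/
theorem norm_sliceA_le (h : SliceHyp M κ c C φg φD r) (s : ℝ) : ‖sliceA φg φD s‖ ≤ KA M C := by
  have h1 := h.D_bound 0 (by omega) s
  have h2 := h.g_bound 0 (by omega) s
  rw [iteratedDeriv_zero] at h1 h2
  rw [sliceA]
  calc ‖(1 : ℂ) - φD s * φg s‖ ≤ ‖(1 : ℂ)‖ + ‖φD s * φg s‖ := norm_sub_le _ _
    _ = 1 + ‖φD s‖ * ‖φg s‖ := by rw [norm_one, norm_mul]
    _ ≤ 1 + C * C := by gcongr; exact h.C_nonneg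
    _ ≤ KA M C := by
        rw [KA]
        have h2M : (2 : ℝ) ≤ 2 ^ (M + 1) := by
          calc (2 : ℝ) = 2 ^ 1 := by norm_num
            _ ≤ 2 ^ (M + 1) := pow_le_pow_right₀ (by norm_num) (by omega)
        have hC1 : 1 ≤ C * C := by nlinarith [h.one_le_C]
        nlinarith [h.one_le_C]

/-- **The first derivative of `φ_A` vanishes to order `2 - κ`**: `‖φ_A'‖ ≤ K_A r^{2-κ}` (`M ≥ 1`).
[cite: Hara2008, (4.22) ("`|∂Ĵ(k)| ≤ sup|∂²Ĵ| |k| = c|k|`")] -/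
theorem norm_iteratedDeriv_one_sliceA_le (h : SliceHyp M κ c C φg φD r) (hM : 1 ≤ M) (s : ℝ) :
    ‖iteratedDeriv 1 (sliceA φg φD) s‖ ≤ KA M C * r s ^ (2 - κ) := by
  have hD : ContDiffAt ℝ 1 φD s := (h.contDiff_D.of_le (by exact_mod_cast (by omega : 1 ≤ M + 1))).contDiffAt
  have hg : ContDiffAt ℝ 1 φg s := (h.contDiff_g.of_le (by exact_mod_cast hM)).contDiffAt
  have hsub : iteratedDeriv 1 (sliceA φg φD) s = -iteratedDeriv 1 (fun t => φD t * φg t) s := by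
    have h1 : sliceA φg φD = (fun _ : ℝ => (1 : ℂ)) - fun t => φD t * φg t := by
      funext t; simp [sliceA]
    rw [h1, iteratedDeriv_sub contDiffAt_const (hD.mul hg), iteratedDeriv_const, if_neg (by omega), zero_sub]
  rw [hsub, norm_neg]
  refine (h.norm_iteratedDeriv_mul_le hM s).trans ?_
  rw [Finset.sum_range_succ, Finset.sum_range_succ, Finset.sum_range_zero, zero_add]
  simp only [Nat.choose_zero_right, Nat.cast_one, one_mul, Nat.sub_zero, Nat.choose_one_right, Nat.sub_self]
  have h0D := h.D_bound 0 (by omega) s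
  have h0g := h.g_bound 0 (by omega) s
  have h1D := h.D_one s
  have h1g := h.g_one hM s
  rw [iteratedDeriv_zero] at h0D h0g ⊢
  have hr : 0 ≤ r s ^ (2 - κ) := Real.rpow_nonneg (h.r_pos s).le _
  have hC := h.C_nonneg
  calc ‖φD s‖ * ‖iteratedDeriv 1 φg s‖ + ‖iteratedDeriv 1 φD s‖ * ‖φg s‖
      ≤ C * (C * r s ^ (2 - κ)) + C * r s ^ (2 - κ) * C := by
        gcongr
    _ = 2 * C ^ 2 * r s ^ (2 - κ) := by ring
    _ ≤ KA M C * r s ^ (2 - κ) := by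
        rw [KA]
        gcongr
        have : (2 : ℝ) ≤ 2 ^ (M + 1) := by
          calc (2 : ℝ) = 2 ^ 1 := by norm_num
            _ ≤ 2 ^ (M + 1) := pow_le_pow_right₀ (by norm_num) (by omega)
        nlinarith [sq_nonneg C]

/-! ### Lemma 4.1 on a slice: `‖φ_G^{(m)}‖ ≤ B_m r^{-(2+mκ)}` -/

/-- **The Leibniz identity with the top term isolated**:
`φ_G^{(m)} φ_A = φ_g^{(m)} - Σ_{i<m} C(m,i) φ_G^{(i)} φ_A^{(m-i)}` (the recursive form of Hara's (4.21); cf.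
`sliceDeriv_kspaceTwoPoint_mul_one_sub` in `LaceExpansionHaraLemma41Cube.lean`). [cite: Hara2008, (4.21)] -/
theorem iteratedDeriv_sliceG_mul (h : SliceHyp M κ c C φg φD r) {m : ℕ} (hm : m ≤ M) (s : ℝ) :
    iteratedDeriv m (sliceG φg φD) s * sliceA φg φD s =
      iteratedDeriv m φg s - ∑ i ∈ Finset.range m, (m.choose i : ℂ) * iteratedDeriv i (sliceG φg φD) s *
        iteratedDeriv (m - i) (sliceA φg φD) s := by
  have hG : ContDiffAt ℝ m (sliceG φg φD) s := (h.contDiff_sliceG.of_le (by exact_mod_cast hm)).contDiffAt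
  have hA : ContDiffAt ℝ m (sliceA φg φD) s := (h.contDiff_sliceA.of_le (by exact_mod_cast hm)).contDiffAt
  have key := iteratedDeriv_mul hG hA
  rw [h.sliceG_mul_sliceA] at key
  rw [key, Finset.sum_range_succ, Nat.choose_self, Nat.cast_one, one_mul, Nat.sub_self, iteratedDeriv_zero]
  ring

/-- `1 ≤ r^{-a}` for `a ≥ 0`. [folklore] -/
theorem one_le_rpow_neg (h : SliceHyp M κ c C φg φD r) (s : ℝ) {a : ℝ} (ha : 0 ≤ a) : 1 ≤ r s ^ (-a) :=
  Real.one_le_rpow_of_pos_of_le_one_of_nonpos (h.r_pos s) (h.r_le_one s) (neg_nonpos.2 ha)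

/-- **Hara's Lemma 4.1 on a slice, with uniform constants**: for every `m ≤ M` there is
`B = B(M, κ, c, C, m) ≥ 0` such that `‖φ_G^{(m)}(s)‖ ≤ B r(s)^{-(2+mκ)}` for EVERY slice datum
obeying `SliceHyp M κ c C` (strong induction on `m` through the isolated Leibniz identity; the
case `κ = 1` is the mechanism `norm_iteratedDeriv_div_mul_pow_le` of `LaceExpansionHaraLemma41.lean`
with `a = 0` — kept here in the `κ`-form the increment theorems below re-run at two points).
[cite: Hara2008, Lemma 4.1 ((4.6)–(4.7): |∂^m Ĝ| ≤ c|k|^{-(2+m)}) and its proof (§4.2)] -/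
theorem exists_norm_iteratedDeriv_sliceG_le (M : ℕ) (κ c C : ℝ) :
    ∀ m, m ≤ M → ∃ B : ℝ, 0 ≤ B ∧ ∀ (φg φD : ℝ → ℂ) (r : ℝ → ℝ), SliceHyp M κ c C φg φD r →
      ∀ s, ‖iteratedDeriv m (sliceG φg φD) s‖ ≤ B * r s ^ (-(2 + m * κ)) := by
  intro m
  induction m using Nat.strong_induction_on with
  | _ m IH =>
  intro hm
  -- constants for the lower orders, as a function of `i`
  have IH' : ∀ i, ∃ B : ℝ, 0 ≤ B ∧ (i < m → ∀ (φg φD : ℝ → ℂ) (r : ℝ → ℝ), SliceHyp M κ c C φg φD r →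
      ∀ s, ‖iteratedDeriv i (sliceG φg φD) s‖ ≤ B * r s ^ (-(2 + i * κ))) := by
    intro i
    by_cases hi : i < m
    · obtain ⟨B, hB0, hB⟩ := IH i hi (by omega)
      exact ⟨B, hB0, fun _ => hB⟩
    · exact ⟨0, le_rfl, fun h => absurd h hi⟩
  choose B hB0 hB using IH'
  set S : ℝ := ∑ i ∈ Finset.range m, (m.choose i : ℝ) * B i with hS
  have hS0 : 0 ≤ S := Finset.sum_nonneg fun i _ => mul_nonneg (Nat.cast_nonneg _) (hB0 i)
  refine ⟨max 0 ((C + KA M C * S) / c), le_max_left _ _, ?_⟩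
  intro φg φD r h s
  have hr := h.r_pos s
  have hr1 := h.r_le_one s
  have hκ1 := h.one_le_kappa
  have hKA := h.one_le_KA
  refine le_trans ?_ (mul_le_mul_of_nonneg_right (le_max_right _ _) (Real.rpow_nonneg hr.le _))
  -- Step 1: `‖D^m G‖ ‖A‖ ≤ C + Σ_{i<m} C(m,i) ‖D^i G‖ ‖D^{m-i} A‖`
  have h1 : ‖iteratedDeriv m (sliceG φg φD) s‖ * ‖sliceA φg φD s‖ ≤
      C + ∑ i ∈ Finset.range m, (m.choose i : ℝ) * ‖iteratedDeriv i (sliceG φg φD) s‖ *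
        ‖iteratedDeriv (m - i) (sliceA φg φD) s‖ := by
    rw [← norm_mul, h.iteratedDeriv_sliceG_mul hm s]
    refine (norm_sub_le _ _).trans (add_le_add (h.g_bound m hm s) ((norm_sum_le _ _).trans (le_of_eq ?_)))
    exact Finset.sum_congr rfl fun i _ => by rw [norm_mul, norm_mul, Complex.norm_natCast]
  -- Step 2: each term is at most `C(m,i) B_i K_A r^{-mκ}`
  have h2 : ∀ i ∈ Finset.range m, (m.choose i : ℝ) * ‖iteratedDeriv i (sliceG φg φD) s‖ *
      ‖iteratedDeriv (m - i) (sliceA φg φD) s‖ ≤ (m.choose i : ℝ) * B i * (KA M C * r s ^ (-(m * κ))) := by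
    intro i hi
    have him : i < m := Finset.mem_range.1 hi
    have hGi := hB i him φg φD r h s
    have hch : (0 : ℝ) ≤ m.choose i := Nat.cast_nonneg _
    rw [mul_assoc, mul_assoc]
    refine mul_le_mul_of_nonneg_left ?_ hch
    rcases Nat.lt_or_ge (m - i) 2 with hmi | hmi
    · -- `m - i = 1`: the first derivative of `φ_A` vanishes to order `2 - κ`
      have hmi1 : m - i = 1 := by omega
      have hA1 := h.norm_iteratedDeriv_one_sliceA_le (by omega) s
      rw [hmi1]
      calc ‖iteratedDeriv i (sliceG φg φD) s‖ * ‖iteratedDeriv 1 (sliceA φg φD) s‖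
          ≤ (B i * r s ^ (-(2 + i * κ))) * (KA M C * r s ^ (2 - κ)) := by
            refine mul_le_mul hGi hA1 (norm_nonneg _) (mul_nonneg (hB0 i) (Real.rpow_nonneg hr.le _))
        _ = B i * (KA M C * r s ^ (-(m * κ))) := by
            have : -(2 + i * κ) + (2 - κ) = -(m * κ) := by
              have : (m : ℝ) = i + 1 := by
                have : m = i + 1 := by omega
                exact_mod_cast this
              rw [this]; ring
            rw [← this, Real.rpow_add hr]; ring
    · -- `m - i ≥ 2`: bounded derivative of `φ_A`, and `r^{-(2+iκ)} ≤ r^{-mκ}`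
      have hAi := h.norm_iteratedDeriv_sliceA_le (i := m - i) (by omega) (by omega) s
      have hexp : r s ^ (-(2 + i * κ)) ≤ r s ^ (-(m * κ)) := by
        refine h.rpow_neg_le_rpow_neg s ?_
        have : (2 : ℝ) ≤ (m - i : ℕ) * κ := by
          have h2 : (2 : ℝ) ≤ (m - i : ℕ) := by exact_mod_cast hmi
          nlinarith
        have hcast : ((m - i : ℕ) : ℝ) = m - i := by
          rw [Nat.cast_sub (by omega)]
        rw [hcast] at this
        linarith
      calc ‖iteratedDeriv i (sliceG φg φD) s‖ * ‖iteratedDeriv (m - i) (sliceA φg φD) s‖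
          ≤ (B i * r s ^ (-(2 + i * κ))) * KA M C :=
            mul_le_mul hGi hAi (norm_nonneg _) (mul_nonneg (hB0 i) (Real.rpow_nonneg hr.le _))
        _ ≤ (B i * r s ^ (-(m * κ))) * KA M C := by gcongr; exact hB0 i
        _ = B i * (KA M C * r s ^ (-(m * κ))) := by ring
  -- Step 3: sum up and divide by `‖A‖ ≥ c r²`
  have h3 : ‖iteratedDeriv m (sliceG φg φD) s‖ * ‖sliceA φg φD s‖ ≤ (C + KA M C * S) * r s ^ (-(m * κ)) := by
    refine h1.trans ?_
    have hsum := Finset.sum_le_sum h2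
    rw [← Finset.sum_mul] at hsum
    have hC1 : C ≤ C * r s ^ (-(m * κ)) :=
      le_mul_of_one_le_right h.C_nonneg (h.one_le_rpow_neg s (by positivity))
    calc C + ∑ i ∈ Finset.range m, (m.choose i : ℝ) * ‖iteratedDeriv i (sliceG φg φD) s‖ *
          ‖iteratedDeriv (m - i) (sliceA φg φD) s‖
        ≤ C * r s ^ (-(m * κ)) + S * (KA M C * r s ^ (-(m * κ))) := add_le_add hC1 hsum
      _ = (C + KA M C * S) * r s ^ (-(m * κ)) := by ring
  have hA := h.le_norm_sliceA s
  have hcr : 0 < c * r s ^ 2 := mul_pos h.c_pos (pow_pos hr 2)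
  have hApos : 0 < ‖sliceA φg φD s‖ := lt_of_lt_of_le hcr hA
  have hnum : 0 ≤ (C + KA M C * S) := by nlinarith [h.C_nonneg]
  calc ‖iteratedDeriv m (sliceG φg φD) s‖
      ≤ (C + KA M C * S) * r s ^ (-(m * κ)) / ‖sliceA φg φD s‖ := by
        rw [le_div_iff₀ hApos]; exact h3
    _ ≤ (C + KA M C * S) * r s ^ (-(m * κ)) / (c * r s ^ 2) := by
        gcongr
    _ = (C + KA M C * S) / c * r s ^ (-(2 + m * κ)) := by
        have h2 : r s ^ (-(2 : ℝ)) = (r s ^ 2)⁻¹ := by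
          rw [Real.rpow_neg hr.le, show ((2 : ℝ)) = ((2 : ℕ) : ℝ) by norm_num, Real.rpow_natCast]
        rw [show -(2 + (m : ℝ) * κ) = -(m * κ) + (-2) by ring, Real.rpow_add hr, h2]
        field_simp

/-! ### Increments: mean-value bounds below the top order -/

end SliceHyp

/-- **Mean value for an iterated derivative**: if `‖φ^{(i+1)}‖ ≤ K` on `[s, s+u]` then
`‖φ^{(i)}(s+u) - φ^{(i)}(s)‖ ≤ K u`. [folklore] -/
theorem norm_iteratedDeriv_sub_le {φ : ℝ → ℂ} {n i : ℕ} (hφ : ContDiff ℝ n φ) (hi : i < n)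
    {s u K : ℝ} (hu : 0 ≤ u) (hK : ∀ t ∈ Icc s (s + u), ‖iteratedDeriv (i + 1) φ t‖ ≤ K) :
    ‖iteratedDeriv i φ (s + u) - iteratedDeriv i φ s‖ ≤ K * u := by
  have hdiff : ∀ t ∈ Icc s (s + u), DifferentiableAt ℝ (iteratedDeriv i φ) t := fun t _ =>
    (hφ.differentiable_iteratedDeriv i (by exact_mod_cast hi)) t
  have hbound : ∀ t ∈ Icc s (s + u), ‖deriv (iteratedDeriv i φ) t‖ ≤ K := fun t ht => by
    rw [← iteratedDeriv_succ]; exact hK t ht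
  have h := (convex_Icc s (s + u)).norm_image_sub_le_of_norm_deriv_le hdiff hbound
    (left_mem_Icc.2 (by linarith)) (right_mem_Icc.2 (by linarith))
  rwa [add_sub_cancel_left, Real.norm_eq_abs, abs_of_nonneg hu] at h

namespace SliceHyp

variable {M : ℕ} {κ c C : ℝ} {φg φD : ℝ → ℂ} {r : ℝ → ℝ}

/-- `‖φ_D^{(j)}(s+u) - φ_D^{(j)}(s)‖ ≤ C u` for `j ≤ M`. [folklore] -/
theorem norm_incr_D (h : SliceHyp M κ c C φg φD r) {j : ℕ} (hj : j ≤ M) {s u : ℝ} (hu : 0 ≤ u) :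
    ‖iteratedDeriv j φD (s + u) - iteratedDeriv j φD s‖ ≤ C * u :=
  norm_iteratedDeriv_sub_le (n := M + 1) h.contDiff_D (by omega) hu fun t _ => h.D_bound (j + 1) (by omega) t

/-- `‖φ_g^{(i)}(s+u) - φ_g^{(i)}(s)‖ ≤ C u` for `i < M`. [folklore] -/
theorem norm_incr_g (h : SliceHyp M κ c C φg φD r) {i : ℕ} (hi : i < M) {s u : ℝ} (hu : 0 ≤ u) :
    ‖iteratedDeriv i φg (s + u) - iteratedDeriv i φg s‖ ≤ C * u :=
  norm_iteratedDeriv_sub_le h.contDiff_g hi hu fun t _ => h.g_bound (i + 1) (by omega) t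

/-- `‖φ_A^{(j)}(s+u) - φ_A^{(j)}(s)‖ ≤ K_A u` for `1 ≤ j < M`. [folklore] -/
theorem norm_incr_A (h : SliceHyp M κ c C φg φD r) {j : ℕ} (hj1 : 1 ≤ j) (hj : j < M) {s u : ℝ} (hu : 0 ≤ u) :
    ‖iteratedDeriv j (sliceA φg φD) (s + u) - iteratedDeriv j (sliceA φg φD) s‖ ≤ KA M C * u :=
  norm_iteratedDeriv_sub_le h.contDiff_sliceA hj hu fun t _ => h.norm_iteratedDeriv_sliceA_le (by omega) (by omega) t

/-- `‖φ_A(s+u) - φ_A(s)‖ ≤ 3 K_A r₀^{2-κ} u` when `r ≤ 3r₀` on `[s, s+u]` (`M ≥ 1`). [folklore] -/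
theorem norm_incr_A_zero (h : SliceHyp M κ c C φg φD r) (hM : 1 ≤ M) {s u r₀ : ℝ} (hu : 0 ≤ u) (hr₀ : 0 < r₀)
    (hseg : ∀ t ∈ Icc s (s + u), r t ≤ 3 * r₀) :
    ‖sliceA φg φD (s + u) - sliceA φg φD s‖ ≤ 3 * KA M C * r₀ ^ (2 - κ) * u := by
  have hK : ∀ t ∈ Icc s (s + u), ‖iteratedDeriv (0 + 1) (sliceA φg φD) t‖ ≤ 3 * KA M C * r₀ ^ (2 - κ) := by
    intro t ht
    refine (h.norm_iteratedDeriv_one_sliceA_le hM t).trans ?_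
    have hκ := h.kappa_le_two
    have hκ1 := h.one_le_kappa
    have h1 : r t ^ (2 - κ) ≤ (3 * r₀) ^ (2 - κ) :=
      Real.rpow_le_rpow (h.r_pos t).le (hseg t ht) (by linarith)
    have h2 : (3 * r₀) ^ (2 - κ) ≤ 3 * r₀ ^ (2 - κ) := by
      rw [Real.mul_rpow (by norm_num) hr₀.le]
      gcongr
      calc (3 : ℝ) ^ (2 - κ) ≤ 3 ^ (1 : ℝ) := Real.rpow_le_rpow_of_exponent_le (by norm_num) (by linarith)
        _ = 3 := Real.rpow_one 3
    have hKA : 0 ≤ KA M C := le_trans zero_le_one h.one_le_KA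
    calc KA M C * r t ^ (2 - κ) ≤ KA M C * (3 * r₀ ^ (2 - κ)) := by gcongr; exact h1.trans h2
      _ = 3 * KA M C * r₀ ^ (2 - κ) := by ring
  have h0 := norm_iteratedDeriv_sub_le (i := 0) (s := s) h.contDiff_sliceA (by exact_mod_cast hM) hu hK
  simpa only [iteratedDeriv_zero] using h0

/-! ### Increments of the top derivative of `φ_A` under a Hölder hypothesis on `φ_g^{(M)}` -/

/-- `φ_A^{(i)} = -Σ_j C(i,j) φ_D^{(j)} φ_g^{(i-j)}` for `1 ≤ i ≤ M`. [folklore] -/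
theorem iteratedDeriv_sliceA_eq (h : SliceHyp M κ c C φg φD r) {i : ℕ} (hi1 : 1 ≤ i) (hi : i ≤ M) (s : ℝ) :
    iteratedDeriv i (sliceA φg φD) s =
      -∑ j ∈ Finset.range (i + 1), (i.choose j : ℂ) * iteratedDeriv j φD s * iteratedDeriv (i - j) φg s := by
  have hD : ContDiffAt ℝ i φD s :=
    (h.contDiff_D.of_le (by exact_mod_cast (Nat.le_succ_of_le hi))).contDiffAt
  have hg : ContDiffAt ℝ i φg s := (h.contDiff_g.of_le (by exact_mod_cast hi)).contDiffAt
  have h1 : sliceA φg φD = (fun _ : ℝ => (1 : ℂ)) - fun t => φD t * φg t := by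
    funext t; simp [sliceA]
  rw [h1, iteratedDeriv_sub contDiffAt_const (hD.mul hg), iteratedDeriv_const, if_neg (by omega), zero_sub,
    iteratedDeriv_fun_mul hD hg]

/-- The Hölder constant for `φ_A^{(M)}`: `K_H = 2^M C (2C + C_H)`. [folklore] -/
def KH (M : ℕ) (C CH : ℝ) : ℝ := 2 ^ M * C * (2 * C + CH)

/-- **Hölder continuity of `φ_A^{(M)}`**: if `‖φ_g^{(M)}(s+u) - φ_g^{(M)}(s)‖ ≤ C_H u^θ`
(`0 ≤ u ≤ 1`) then `‖φ_A^{(M)}(s+u) - φ_A^{(M)}(s)‖ ≤ K_H u^θ` (`M ≥ 1`, `θ ≤ 1`). [folklore] -/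
theorem norm_incr_A_top (h : SliceHyp M κ c C φg φD r) (hM : 1 ≤ M) {θ CH : ℝ} (hθ1 : θ ≤ 1)
    (hCH : 0 ≤ CH)
    (hH : ∀ s u : ℝ, 0 ≤ u → u ≤ 1 → ‖iteratedDeriv M φg (s + u) - iteratedDeriv M φg s‖ ≤ CH * u ^ θ)
    {s u : ℝ} (hu : 0 ≤ u) (hu1 : u ≤ 1) :
    ‖iteratedDeriv M (sliceA φg φD) (s + u) - iteratedDeriv M (sliceA φg φD) s‖ ≤ KH M C CH * u ^ θ := by
  have hC := h.C_nonneg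
  have huθ : u ≤ u ^ θ := Real.self_le_rpow_of_le_one hu hu1 hθ1
  have huθ0 : 0 ≤ u ^ θ := Real.rpow_nonneg hu θ
  rw [h.iteratedDeriv_sliceA_eq hM le_rfl, h.iteratedDeriv_sliceA_eq hM le_rfl, neg_sub_neg, ← Finset.sum_sub_distrib]
  refine (norm_sum_le _ _).trans ?_
  -- each term
  have hterm : ∀ j ∈ Finset.range (M + 1),
      ‖(M.choose j : ℂ) * iteratedDeriv j φD s * iteratedDeriv (M - j) φg s -
        (M.choose j : ℂ) * iteratedDeriv j φD (s + u) * iteratedDeriv (M - j) φg (s + u)‖ ≤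
      (M.choose j : ℝ) * (C * (2 * C + CH)) * u ^ θ := by
    intro j hj
    have hjM : j ≤ M := Nat.lt_succ_iff.1 (Finset.mem_range.1 hj)
    set X := iteratedDeriv j φD with hX
    set Y := iteratedDeriv (M - j) φg with hY
    have hsplit : (M.choose j : ℂ) * X s * Y s - (M.choose j : ℂ) * X (s + u) * Y (s + u) =
        -((M.choose j : ℂ) * ((X (s + u) - X s) * Y (s + u) + X s * (Y (s + u) - Y s))) := by ring
    rw [hsplit, norm_neg, norm_mul, Complex.norm_natCast, mul_assoc]
    refine mul_le_mul_of_nonneg_left ?_ (Nat.cast_nonneg _)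
    have hδX : ‖X (s + u) - X s‖ ≤ C * u := h.norm_incr_D hjM hu
    have hYb : ‖Y (s + u)‖ ≤ C := h.g_bound (M - j) (by omega) _
    have hXb : ‖X s‖ ≤ C := h.D_bound j (by omega) _
    have hδY : ‖Y (s + u) - Y s‖ ≤ (C + CH) * u ^ θ := by
      rcases Nat.eq_zero_or_pos j with rfl | hj0
      · rw [hY, Nat.sub_zero]
        calc ‖iteratedDeriv M φg (s + u) - iteratedDeriv M φg s‖ ≤ CH * u ^ θ := hH s u hu hu1
          _ ≤ (C + CH) * u ^ θ := by gcongr; linarith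
      · calc ‖Y (s + u) - Y s‖ ≤ C * u := h.norm_incr_g (i := M - j) (by omega) hu
          _ ≤ (C + CH) * u ^ θ := by
              calc C * u ≤ C * u ^ θ := by gcongr
                _ ≤ (C + CH) * u ^ θ := by gcongr; linarith
    calc ‖(X (s + u) - X s) * Y (s + u) + X s * (Y (s + u) - Y s)‖
        ≤ ‖X (s + u) - X s‖ * ‖Y (s + u)‖ + ‖X s‖ * ‖Y (s + u) - Y s‖ := by
          refine (norm_add_le _ _).trans ?_; rw [norm_mul, norm_mul]
      _ ≤ (C * u) * C + C * ((C + CH) * u ^ θ) := by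
          gcongr
      _ ≤ (C * u ^ θ) * C + C * ((C + CH) * u ^ θ) := by gcongr
      _ = C * (2 * C + CH) * u ^ θ := by ring
  refine (Finset.sum_le_sum hterm).trans (le_of_eq ?_)
  rw [← Finset.sum_mul, ← Finset.sum_mul, KH]
  have : ∑ j ∈ Finset.range (M + 1), (M.choose j : ℝ) = 2 ^ M := by exact_mod_cast Nat.sum_range_choose M
  rw [this]; ring

end SliceHyp

/-! ### Increments of `φ_G^{(m)}` -/

/-- For `0 < r₀ ≤ ρ` and `a ≥ 0`: `ρ^{-a} ≤ r₀^{-a}`. [folklore] -/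
theorem rpow_neg_antitone {r₀ ρ a : ℝ} (hr₀ : 0 < r₀) (hle : r₀ ≤ ρ) (ha : 0 ≤ a) : ρ ^ (-a) ≤ r₀ ^ (-a) :=
  Real.rpow_le_rpow_of_nonpos hr₀ hle (neg_nonpos.2 ha)

/-- For `0 < r₀ ≤ 1` and `a ≤ b`: `r₀^{-a} ≤ r₀^{-b}`. [folklore] -/
theorem rpow_neg_mono_exp {r₀ a b : ℝ} (hr₀ : 0 < r₀) (hr₁ : r₀ ≤ 1) (hab : a ≤ b) : r₀ ^ (-a) ≤ r₀ ^ (-b) :=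
  Real.rpow_le_rpow_of_exponent_ge hr₀ hr₁ (neg_le_neg hab)

namespace SliceHyp

variable {M : ℕ} {κ c C : ℝ} {φg φD : ℝ → ℂ} {r : ℝ → ℝ}

/-- **Increments below the top order**: for `m < M` there is `B ≥ 0` (depending only on
`M, κ, c, C`) with `‖φ_G^{(m)}(s+u) - φ_G^{(m)}(s)‖ ≤ B u r₀^{-(2+(m+1)κ)}` whenever
`r ≥ r₀ > 0` on `[s, s+u]`. [cite: Hara2008, Lemma 4.1 (used through the mean value theorem)] -/
theorem exists_norm_incr_sliceG_le (M : ℕ) (κ c C : ℝ) {m : ℕ} (hm : m < M) :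
    ∃ B : ℝ, 0 ≤ B ∧ ∀ (φg φD : ℝ → ℂ) (r : ℝ → ℝ), SliceHyp M κ c C φg φD r →
      ∀ (s u r₀ : ℝ), 0 ≤ u → 0 < r₀ → (∀ t ∈ Icc s (s + u), r₀ ≤ r t) →
        ‖iteratedDeriv m (sliceG φg φD) (s + u) - iteratedDeriv m (sliceG φg φD) s‖ ≤
          B * u * r₀ ^ (-(2 + (m + 1) * κ)) := by
  obtain ⟨B, hB0, hB⟩ := exists_norm_iteratedDeriv_sliceG_le M κ c C (m + 1) hm
  refine ⟨B, hB0, fun φg φD r h s u r₀ hu hr₀ hseg => ?_⟩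
  have hκ : 0 ≤ κ := le_trans zero_le_one h.one_le_kappa
  have hK : ∀ t ∈ Icc s (s + u), ‖iteratedDeriv (m + 1) (sliceG φg φD) t‖ ≤ B * r₀ ^ (-(2 + (m + 1) * κ)) := by
    intro t ht
    refine (hB φg φD r h t).trans ?_
    push_cast
    exact mul_le_mul_of_nonneg_left (rpow_neg_antitone hr₀ (hseg t ht) (by positivity)) hB0
  calc ‖iteratedDeriv m (sliceG φg φD) (s + u) - iteratedDeriv m (sliceG φg φD) s‖
      ≤ B * r₀ ^ (-(2 + (m + 1) * κ)) * u := norm_iteratedDeriv_sub_le h.contDiff_sliceG hm hu hK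
    _ = B * u * r₀ ^ (-(2 + (m + 1) * κ)) := by ring

end SliceHyp

/-- The increment identity for `X = φ_G^{(M)}`: with `X φ_A = N`,
`X(s') - X(s) = (N(s') - N(s) - X(s)(φ_A(s') - φ_A(s)))/φ_A(s')`. [folklore] -/
theorem incr_div_identity {X A N : ℝ → ℂ} {s s' : ℝ} (h1 : X s' * A s' = N s') (h2 : X s * A s = N s)
    (hA : A s' ≠ 0) : X s' - X s = (N s' - N s - X s * (A s' - A s)) / A s' := by
  rw [eq_div_iff hA, ← h1, ← h2]; ring

namespace SliceHyp

variable {M : ℕ} {κ c C : ℝ} {φg φD : ℝ → ℂ} {r : ℝ → ℝ}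

/-- **Increment of the top derivative** (Hara's case `⌊φ⌋ < α ≤ φ`): if moreover
`‖φ_g^{(M)}(s+u) - φ_g^{(M)}(s)‖ ≤ C_H u^θ` (`0 ≤ u ≤ 1`, `θ ≤ 1`), `M ≥ 1` and `Mκ ≥ 2`,
then there is `B ≥ 0` (depending only on `M, κ, c, C, θ, C_H`) with
`‖φ_G^{(M)}(s+u) - φ_G^{(M)}(s)‖ ≤ B (u^θ r₀^{-(2+Mκ)} + u r₀^{-(2+(M+1)κ)})` whenever
`r₀ ≤ r ≤ 3r₀` on `[s, s+u]`. [cite: Hara2008, §4.1.4 (the case α > ⌊φ⌋; here via increments of the Leibniz identity)] -/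
theorem exists_norm_incr_sliceG_top_le (M : ℕ) (κ c C θ CH : ℝ) (hM : 1 ≤ M) (hMκ : 2 ≤ M * κ)
    (hθ1 : θ ≤ 1) (hCH : 0 ≤ CH) :
    ∃ B : ℝ, 0 ≤ B ∧ ∀ (φg φD : ℝ → ℂ) (r : ℝ → ℝ), SliceHyp M κ c C φg φD r →
      (∀ s u : ℝ, 0 ≤ u → u ≤ 1 → ‖iteratedDeriv M φg (s + u) - iteratedDeriv M φg s‖ ≤ CH * u ^ θ) →
      ∀ (s u r₀ : ℝ), 0 ≤ u → u ≤ 1 → 0 < r₀ → (∀ t ∈ Icc s (s + u), r₀ ≤ r t ∧ r t ≤ 3 * r₀) →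
        ‖iteratedDeriv M (sliceG φg φD) (s + u) - iteratedDeriv M (sliceG φg φD) s‖ ≤
          B * (u ^ θ * r₀ ^ (-(2 + M * κ)) + u * r₀ ^ (-(2 + (M + 1) * κ))) := by
  -- uniform constants for the derivatives (`i ≤ M`) and the increments (`i < M`)
  have hder : ∀ i, ∃ B : ℝ, 0 ≤ B ∧ (i ≤ M → ∀ (φg φD : ℝ → ℂ) (r : ℝ → ℝ), SliceHyp M κ c C φg φD r →
      ∀ s, ‖iteratedDeriv i (sliceG φg φD) s‖ ≤ B * r s ^ (-(2 + i * κ))) := by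
    intro i
    by_cases hi : i ≤ M
    · obtain ⟨B, hB0, hB⟩ := exists_norm_iteratedDeriv_sliceG_le M κ c C i hi
      exact ⟨B, hB0, fun _ => hB⟩
    · exact ⟨0, le_rfl, fun h => absurd h hi⟩
  choose Bd hBd0 hBd using hder
  have hinc : ∀ i, ∃ B : ℝ, 0 ≤ B ∧ (i < M → ∀ (φg φD : ℝ → ℂ) (r : ℝ → ℝ), SliceHyp M κ c C φg φD r →
      ∀ (s u r₀ : ℝ), 0 ≤ u → 0 < r₀ → (∀ t ∈ Icc s (s + u), r₀ ≤ r t) →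
        ‖iteratedDeriv i (sliceG φg φD) (s + u) - iteratedDeriv i (sliceG φg φD) s‖ ≤
          B * u * r₀ ^ (-(2 + (i + 1) * κ))) := by
    intro i
    by_cases hi : i < M
    · obtain ⟨B, hB0, hB⟩ := exists_norm_incr_sliceG_le M κ c C hi
      exact ⟨B, hB0, fun _ => hB⟩
    · exact ⟨0, le_rfl, fun h => absurd h hi⟩
  choose Bi hBi0 hBi using hinc
  -- the constant
  set SR : ℝ := ∑ i ∈ Finset.range M, (M.choose i : ℝ) * (3 * KA M C * Bi i + KA M C * Bd i + KH M C CH * Bd i)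
    with hSR
  set Q : ℝ := CH + SR + 3 * KA M C * Bd M with hQ
  by_cases hc : 0 < c
  swap
  · exact ⟨0, le_rfl, fun φg φD r h => absurd h.c_pos hc⟩
  by_cases hC1 : 1 ≤ C
  swap
  · exact ⟨0, le_rfl, fun φg φD r h => absurd h.one_le_C hC1⟩
  have hC0 : 0 ≤ C := le_trans zero_le_one hC1
  have hKA0 : 0 ≤ KA M C := by rw [KA]; positivity
  have hKH0 : 0 ≤ KH M C CH := by rw [KH]; positivity
  have hcoef0 : ∀ i, 0 ≤ 3 * KA M C * Bi i + KA M C * Bd i + KH M C CH * Bd i := fun i =>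
    add_nonneg (add_nonneg (mul_nonneg (mul_nonneg (by norm_num) hKA0) (hBi0 i)) (mul_nonneg hKA0 (hBd0 i)))
      (mul_nonneg hKH0 (hBd0 i))
  have hSR0 : 0 ≤ SR := Finset.sum_nonneg fun i _ => mul_nonneg (Nat.cast_nonneg _) (hcoef0 i)
  have hQ0 : 0 ≤ Q := add_nonneg (add_nonneg hCH hSR0) (mul_nonneg (mul_nonneg (by norm_num) hKA0) (hBd0 M))
  refine ⟨Q / c, div_nonneg hQ0 hc.le, ?_⟩
  intro φg φD r h hH s u r₀ hu hu1 hr₀ hseg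
  -- notation
  set G := sliceG φg φD with hG
  set A := sliceA φg φD with hA
  set R : ℝ → ℂ := fun t => ∑ i ∈ Finset.range M, (M.choose i : ℂ) * iteratedDeriv i G t *
    iteratedDeriv (M - i) A t with hR
  have hκ1 := h.one_le_kappa
  have hκ2 := h.kappa_le_two
  have hκ0 : 0 ≤ κ := by linarith
  have hlow : ∀ t ∈ Icc s (s + u), r₀ ≤ r t := fun t ht => (hseg t ht).1
  have hs : s ∈ Icc s (s + u) := left_mem_Icc.2 (by linarith)
  have hs' : s + u ∈ Icc s (s + u) := right_mem_Icc.2 (by linarith)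
  have hr₀1 : r₀ ≤ 1 := (hlow s hs).trans (h.r_le_one s)
  have huθ : u ≤ u ^ θ := Real.self_le_rpow_of_le_one hu hu1 hθ1
  have huθ0 : 0 ≤ u ^ θ := Real.rpow_nonneg hu θ
  -- the two target shapes (before dividing by `c r₀²`)
  set T₁ : ℝ := u ^ θ * r₀ ^ (-(M * κ)) with hT₁
  set T₂ : ℝ := u * r₀ ^ (-((M + 1) * κ)) with hT₂
  have hT₁0 : 0 ≤ T₁ := mul_nonneg huθ0 (Real.rpow_nonneg hr₀.le _)
  have hT₂0 : 0 ≤ T₂ := mul_nonneg hu (Real.rpow_nonneg hr₀.le _)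
  have hT0 : 0 ≤ T₁ + T₂ := add_nonneg hT₁0 hT₂0
  -- pointwise bounds at `s` and `s + u`
  have hGi : ∀ i, i ≤ M → ‖iteratedDeriv i G s‖ ≤ Bd i * r₀ ^ (-(2 + i * κ)) := fun i hi =>
    (hBd i hi φg φD r h s).trans (mul_le_mul_of_nonneg_left (rpow_neg_antitone hr₀ (hlow s hs) (by positivity)) (hBd0 i))
  have hδG : ∀ i, i < M → ‖iteratedDeriv i G (s + u) - iteratedDeriv i G s‖ ≤ Bi i * u * r₀ ^ (-(2 + (i + 1) * κ)) :=
    fun i hi => hBi i hi φg φD r h s u r₀ hu hr₀ hlow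
  have hr3 : r (s + u) ^ (2 - κ) ≤ 3 * r₀ ^ (2 - κ) := by
    calc r (s + u) ^ (2 - κ) ≤ (3 * r₀) ^ (2 - κ) :=
          Real.rpow_le_rpow (h.r_pos _).le (hseg _ hs').2 (by linarith)
      _ = 3 ^ (2 - κ) * r₀ ^ (2 - κ) := Real.mul_rpow (by norm_num) hr₀.le
      _ ≤ 3 * r₀ ^ (2 - κ) := by
          gcongr
          calc (3 : ℝ) ^ (2 - κ) ≤ 3 ^ (1 : ℝ) := Real.rpow_le_rpow_of_exponent_le (by norm_num) (by linarith)
            _ = 3 := Real.rpow_one 3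
  -- Step 1: the terms of `R = Σ_{i<M} C(M,i) G^{(i)} A^{(M-i)}`
  have hRterm : ∀ i ∈ Finset.range M,
      ‖(M.choose i : ℂ) * iteratedDeriv i G (s + u) * iteratedDeriv (M - i) A (s + u) -
        (M.choose i : ℂ) * iteratedDeriv i G s * iteratedDeriv (M - i) A s‖ ≤
      (M.choose i : ℝ) * (3 * KA M C * Bi i + KA M C * Bd i + KH M C CH * Bd i) * (T₁ + T₂) := by
    intro i hi
    have hiM : i < M := Finset.mem_range.1 hi
    set X := iteratedDeriv i G with hX
    set Y := iteratedDeriv (M - i) A with hY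
    have hsplit : (M.choose i : ℂ) * X (s + u) * Y (s + u) - (M.choose i : ℂ) * X s * Y s =
        (M.choose i : ℂ) * ((X (s + u) - X s) * Y (s + u) + X s * (Y (s + u) - Y s)) := by ring
    rw [hsplit, norm_mul, Complex.norm_natCast, mul_assoc]
    refine mul_le_mul_of_nonneg_left ?_ (Nat.cast_nonneg _)
    -- first product: `‖δX‖ ‖Y(s+u)‖ ≤ 3 K_A Bi_i T₂`
    have hP1 : ‖X (s + u) - X s‖ * ‖Y (s + u)‖ ≤ 3 * KA M C * Bi i * T₂ := by
      rcases Nat.lt_or_ge (M - i) 2 with hMi | hMi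
      · -- `M - i = 1`
        have hMi1 : M - i = 1 := by omega
        have hYb : ‖Y (s + u)‖ ≤ KA M C * r (s + u) ^ (2 - κ) := by
          rw [hY, hMi1]; exact h.norm_iteratedDeriv_one_sliceA_le hM _
        have hexp : r₀ ^ (-(2 + (i + 1) * κ)) * r₀ ^ (2 - κ) = r₀ ^ (-((M + 1) * κ)) := by
          rw [← Real.rpow_add hr₀]
          congr 1
          have : (M : ℝ) = i + 1 := by exact_mod_cast (by omega : M = i + 1)
          rw [this]; ring
        calc ‖X (s + u) - X s‖ * ‖Y (s + u)‖
            ≤ (Bi i * u * r₀ ^ (-(2 + (i + 1) * κ))) * (KA M C * (3 * r₀ ^ (2 - κ))) := by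
              refine mul_le_mul (hδG i hiM) (hYb.trans (by gcongr)) (norm_nonneg _) ?_
              exact mul_nonneg (mul_nonneg (hBi0 i) hu) (Real.rpow_nonneg hr₀.le _)
          _ = 3 * KA M C * Bi i * (u * (r₀ ^ (-(2 + (i + 1) * κ)) * r₀ ^ (2 - κ))) := by ring
          _ = 3 * KA M C * Bi i * T₂ := by rw [hexp]
      · -- `M - i ≥ 2`
        have hYb : ‖Y (s + u)‖ ≤ KA M C := h.norm_iteratedDeriv_sliceA_le (i := M - i) (by omega) (by omega) _
        have hexp : r₀ ^ (-(2 + (i + 1) * κ)) ≤ r₀ ^ (-((M + 1) * κ)) := by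
          refine rpow_neg_mono_exp hr₀ hr₀1 ?_
          have h2 : (2 : ℝ) ≤ (M - i : ℕ) := by exact_mod_cast hMi
          have hcast : ((M - i : ℕ) : ℝ) = M - i := by rw [Nat.cast_sub (by omega)]
          rw [hcast] at h2
          nlinarith
        calc ‖X (s + u) - X s‖ * ‖Y (s + u)‖ ≤ (Bi i * u * r₀ ^ (-(2 + (i + 1) * κ))) * KA M C :=
              mul_le_mul (hδG i hiM) hYb (norm_nonneg _)
                (mul_nonneg (mul_nonneg (hBi0 i) hu) (Real.rpow_nonneg hr₀.le _))
          _ ≤ (Bi i * u * r₀ ^ (-((M + 1) * κ))) * KA M C := by gcongr; exact mul_nonneg (hBi0 i) hu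
          _ = KA M C * Bi i * T₂ := by ring
          _ ≤ 3 * KA M C * Bi i * T₂ := by
              have : 0 ≤ KA M C * Bi i * T₂ := mul_nonneg (mul_nonneg hKA0 (hBi0 i)) hT₂0
              linarith
    -- second product: `‖X(s)‖ ‖δY‖ ≤ (K_A + K_H) Bd_i (T₁ + T₂)`
    have hP2 : ‖X s‖ * ‖Y (s + u) - Y s‖ ≤ (KA M C * Bd i + KH M C CH * Bd i) * (T₁ + T₂) := by
      have hXb : ‖X s‖ ≤ Bd i * r₀ ^ (-(2 + i * κ)) := hGi i hiM.le
      rcases Nat.eq_zero_or_pos i with rfl | hi0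
      · -- `i = 0`: Hölder increment of `φ_A^{(M)}`
        have hδY : ‖Y (s + u) - Y s‖ ≤ KH M C CH * u ^ θ := by
          rw [hY, Nat.sub_zero]; exact h.norm_incr_A_top hM hθ1 hCH hH hu hu1
        have hexp : r₀ ^ (-(2 + ((0 : ℕ) : ℝ) * κ)) ≤ r₀ ^ (-(M * κ)) := by
          refine rpow_neg_mono_exp hr₀ hr₀1 ?_; push_cast; linarith
        calc ‖X s‖ * ‖Y (s + u) - Y s‖ ≤ (Bd 0 * r₀ ^ (-(2 + ((0 : ℕ) : ℝ) * κ))) * (KH M C CH * u ^ θ) :=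
              mul_le_mul hXb hδY (norm_nonneg _) (mul_nonneg (hBd0 0) (Real.rpow_nonneg hr₀.le _))
          _ ≤ (Bd 0 * r₀ ^ (-(M * κ))) * (KH M C CH * u ^ θ) := by gcongr; exact hBd0 0
          _ = KH M C CH * Bd 0 * T₁ := by ring
          _ ≤ (KA M C * Bd 0 + KH M C CH * Bd 0) * (T₁ + T₂) := by
              have h1 : 0 ≤ KA M C * Bd 0 * (T₁ + T₂) := mul_nonneg (mul_nonneg hKA0 (hBd0 0)) hT0
              have h2 : 0 ≤ KH M C CH * Bd 0 * T₂ := mul_nonneg (mul_nonneg hKH0 (hBd0 0)) hT₂0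
              linarith [show (KA M C * Bd 0 + KH M C CH * Bd 0) * (T₁ + T₂) =
                KA M C * Bd 0 * (T₁ + T₂) + KH M C CH * Bd 0 * T₁ + KH M C CH * Bd 0 * T₂ by ring]
      · -- `i ≥ 1`: mean value for `φ_A^{(M-i)}`, `1 ≤ M - i < M`
        have hδY : ‖Y (s + u) - Y s‖ ≤ KA M C * u := h.norm_incr_A (j := M - i) (by omega) (by omega) hu
        have hexp : r₀ ^ (-(2 + i * κ)) ≤ r₀ ^ (-((M + 1) * κ)) := by
          refine rpow_neg_mono_exp hr₀ hr₀1 ?_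
          have h2 : (2 : ℝ) ≤ (M + 1 - i : ℕ) := by exact_mod_cast (by omega : 2 ≤ M + 1 - i)
          have hcast : ((M + 1 - i : ℕ) : ℝ) = M + 1 - i := by
            rw [Nat.cast_sub (by omega)]; push_cast; ring
          rw [hcast] at h2
          nlinarith
        calc ‖X s‖ * ‖Y (s + u) - Y s‖ ≤ (Bd i * r₀ ^ (-(2 + i * κ))) * (KA M C * u) :=
              mul_le_mul hXb hδY (norm_nonneg _) (mul_nonneg (hBd0 i) (Real.rpow_nonneg hr₀.le _))
          _ ≤ (Bd i * r₀ ^ (-((M + 1) * κ))) * (KA M C * u) := by gcongr; exact hBd0 i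
          _ = KA M C * Bd i * T₂ := by ring
          _ ≤ (KA M C * Bd i + KH M C CH * Bd i) * (T₁ + T₂) := by
              have h1 : 0 ≤ KA M C * Bd i * T₁ := mul_nonneg (mul_nonneg hKA0 (hBd0 i)) hT₁0
              have h2 : 0 ≤ KH M C CH * Bd i * (T₁ + T₂) := mul_nonneg (mul_nonneg hKH0 (hBd0 i)) hT0
              linarith [show (KA M C * Bd i + KH M C CH * Bd i) * (T₁ + T₂) =
                KA M C * Bd i * T₁ + KA M C * Bd i * T₂ + KH M C CH * Bd i * (T₁ + T₂) by ring]
    calc ‖(X (s + u) - X s) * Y (s + u) + X s * (Y (s + u) - Y s)‖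
        ≤ ‖X (s + u) - X s‖ * ‖Y (s + u)‖ + ‖X s‖ * ‖Y (s + u) - Y s‖ := by
          refine (norm_add_le _ _).trans ?_; rw [norm_mul, norm_mul]
      _ ≤ 3 * KA M C * Bi i * T₂ + (KA M C * Bd i + KH M C CH * Bd i) * (T₁ + T₂) := add_le_add hP1 hP2
      _ ≤ (3 * KA M C * Bi i + KA M C * Bd i + KH M C CH * Bd i) * (T₁ + T₂) := by
          have : 0 ≤ 3 * KA M C * Bi i * T₁ := mul_nonneg (mul_nonneg (mul_nonneg (by norm_num) hKA0) (hBi0 i)) hT₁0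
          linarith [show (3 * KA M C * Bi i + KA M C * Bd i + KH M C CH * Bd i) * (T₁ + T₂) =
            3 * KA M C * Bi i * T₁ + 3 * KA M C * Bi i * T₂ + (KA M C * Bd i + KH M C CH * Bd i) * (T₁ + T₂) by ring]
  -- Step 2: the increment of `R`
  have hδR : ‖R (s + u) - R s‖ ≤ SR * (T₁ + T₂) := by
    simp only [hR]
    rw [← Finset.sum_sub_distrib, hSR, Finset.sum_mul]
    exact (norm_sum_le _ _).trans (Finset.sum_le_sum hRterm)
  -- Step 3: the increment of `φ_g^{(M)}`
  have hδg : ‖iteratedDeriv M φg (s + u) - iteratedDeriv M φg s‖ ≤ CH * (T₁ + T₂) := by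
    refine (hH s u hu hu1).trans (mul_le_mul_of_nonneg_left ?_ hCH)
    calc u ^ θ = u ^ θ * 1 := (mul_one _).symm
      _ ≤ u ^ θ * r₀ ^ (-(M * κ)) := by
          gcongr
          exact Real.one_le_rpow_of_pos_of_le_one_of_nonpos hr₀ hr₀1 (neg_nonpos.2 (by positivity))
      _ = T₁ := rfl
      _ ≤ T₁ + T₂ := le_add_of_nonneg_right hT₂0
  -- Step 4: `‖X(s)‖ ‖A(s+u) - A(s)‖ ≤ 3 K_A Bd_M T₂`
  have hXδA : ‖iteratedDeriv M G s‖ * ‖A (s + u) - A s‖ ≤ 3 * KA M C * Bd M * T₂ := by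
    have hXb := hGi M le_rfl
    have hδA : ‖A (s + u) - A s‖ ≤ 3 * KA M C * r₀ ^ (2 - κ) * u :=
      h.norm_incr_A_zero hM hu hr₀ fun t ht => (hseg t ht).2
    have hexp : r₀ ^ (-(2 + (M : ℝ) * κ)) * r₀ ^ (2 - κ) = r₀ ^ (-((M + 1) * κ)) := by
      rw [← Real.rpow_add hr₀]; congr 1; ring
    calc ‖iteratedDeriv M G s‖ * ‖A (s + u) - A s‖
        ≤ (Bd M * r₀ ^ (-(2 + M * κ))) * (3 * KA M C * r₀ ^ (2 - κ) * u) :=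
          mul_le_mul hXb hδA (norm_nonneg _) (mul_nonneg (hBd0 M) (Real.rpow_nonneg hr₀.le _))
      _ = 3 * KA M C * Bd M * (u * (r₀ ^ (-(2 + (M : ℝ) * κ)) * r₀ ^ (2 - κ))) := by ring
      _ = 3 * KA M C * Bd M * T₂ := by rw [hexp]
  -- Step 5: assemble the numerator and divide by `‖A(s+u)‖ ≥ c r₀²`
  have hid := incr_div_identity (X := iteratedDeriv M G) (A := A)
    (N := fun t => iteratedDeriv M φg t - R t) (s := s) (s' := s + u)
    (h.iteratedDeriv_sliceG_mul le_rfl (s + u)) (h.iteratedDeriv_sliceG_mul le_rfl s) (h.sliceA_ne_zero (s + u))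
  have hnum : ‖(iteratedDeriv M φg (s + u) - R (s + u)) - (iteratedDeriv M φg s - R s) -
      iteratedDeriv M G s * (A (s + u) - A s)‖ ≤ Q * (T₁ + T₂) := by
    calc ‖(iteratedDeriv M φg (s + u) - R (s + u)) - (iteratedDeriv M φg s - R s) -
          iteratedDeriv M G s * (A (s + u) - A s)‖
        ≤ ‖iteratedDeriv M φg (s + u) - iteratedDeriv M φg s‖ + ‖R (s + u) - R s‖ +
            ‖iteratedDeriv M G s‖ * ‖A (s + u) - A s‖ := by
          rw [show (iteratedDeriv M φg (s + u) - R (s + u)) - (iteratedDeriv M φg s - R s) -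
              iteratedDeriv M G s * (A (s + u) - A s) =
              (iteratedDeriv M φg (s + u) - iteratedDeriv M φg s) - (R (s + u) - R s) -
              iteratedDeriv M G s * (A (s + u) - A s) by ring]
          refine (norm_sub_le _ _).trans (add_le_add ((norm_sub_le _ _).trans le_rfl) (le_of_eq (norm_mul _ _)))
      _ ≤ CH * (T₁ + T₂) + SR * (T₁ + T₂) + 3 * KA M C * Bd M * T₂ := add_le_add (add_le_add hδg hδR) hXδA
      _ ≤ Q * (T₁ + T₂) := by
          rw [hQ]
          have : 0 ≤ 3 * KA M C * Bd M * T₁ := mul_nonneg (mul_nonneg (mul_nonneg (by norm_num) hKA0) (hBd0 M)) hT₁0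
          linarith [show (CH + SR + 3 * KA M C * Bd M) * (T₁ + T₂) =
            CH * (T₁ + T₂) + SR * (T₁ + T₂) + 3 * KA M C * Bd M * T₂ + 3 * KA M C * Bd M * T₁ by ring]
  have hAlow : c * r₀ ^ 2 ≤ ‖A (s + u)‖ := by
    calc c * r₀ ^ 2 ≤ c * r (s + u) ^ 2 := by
          have := hlow _ hs'
          gcongr
      _ ≤ ‖A (s + u)‖ := h.le_norm_sliceA (s + u)
  have hcr : 0 < c * r₀ ^ 2 := mul_pos hc (pow_pos hr₀ 2)
  rw [hid, norm_div]
  calc ‖(iteratedDeriv M φg (s + u) - R (s + u)) - (iteratedDeriv M φg s - R s) -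
        iteratedDeriv M G s * (A (s + u) - A s)‖ / ‖A (s + u)‖
      ≤ Q * (T₁ + T₂) / (c * r₀ ^ 2) := by
        gcongr
    _ = Q / c * (u ^ θ * r₀ ^ (-(2 + M * κ)) + u * r₀ ^ (-(2 + (M + 1) * κ))) := by
        have h2 : (r₀ ^ 2)⁻¹ = r₀ ^ (-(2 : ℝ)) := by
          rw [Real.rpow_neg hr₀.le, show ((2 : ℝ)) = ((2 : ℕ) : ℝ) by norm_num, Real.rpow_natCast]
        have e1 : r₀ ^ (-(M * κ)) * r₀ ^ (-(2 : ℝ)) = r₀ ^ (-(2 + M * κ)) := by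
          rw [← Real.rpow_add hr₀]; congr 1; ring
        have e2 : r₀ ^ (-((M + 1) * κ)) * r₀ ^ (-(2 : ℝ)) = r₀ ^ (-(2 + (M + 1) * κ)) := by
          rw [← Real.rpow_add hr₀]; congr 1; ring
        rw [← e1, ← e2, hT₁, hT₂, div_mul_eq_mul_div, mul_div_assoc, mul_div_assoc]
        congr 1
        rw [div_eq_mul_inv, mul_inv, h2]
        field_simp

end SliceHyp

end Literature.Barriers.CriticalPhenomena.HaraNorms
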